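import Literature.NumberTheory.LFunctions.RiemannSiegelPhase
import Literature.NumberTheory.LFunctions.RiemannSiegelStirling
import Literature.NumberTheory.LFunctions.LevinsonMontgomeryBacklund
import Mathlib.Analysis.Calculus.MeanValue
import HarnessLib

/-!
# The sign of Hardy's `Z(t)` from `ζ(½ + it)` and a rough value of `θ(t)`

Trunk T-ANT (`NumberTheory/LFunctions`). A certified computation locates zeros of `ζ` on the
critical line by sign changes of Hardy's function `Z(t) = e^{iθ(t)} ζ(½ + it)` (`Literature.NumberTheory.LFunctions.hardyZ`).
Evaluating `Z` needs `θ(t) = Im log Γ(¼ + it/2) − (t/2) log π`, but only crudely: for *any* real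
`φ`,

  `Re (e^{iφ} ζ(½ + it)) = Z(t) · cos (φ − θ(t))`   (`rotate_eq`),

since `e^{iθ(t)} ζ(½+it) = Z(t)` is real (`Literature.NumberTheory.LFunctions.ofReal_hardyZ_holds`, `RiemannSiegelPhase.lean`). So
if `|φ − θ(t)| < π/2` the sign of `Z(t)` is the sign of `Re (e^{iφ} ζ(½+it))`
(`hardyZ_pos_of_re_pos`, `hardyZ_neg_of_re_neg`), and a sign change of `Z` between `t₁` and `t₂`
is certified by two validated evaluations of `ζ` on the line and the explicit Stirling
enclosure `|θ(t) − ((t/2)log(t/2π) − t/2 − π/8)| ≤ 2K(¼)/t` (`t ≥ 2`,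
`Literature.NumberTheory.LFunctions.abs_riemannSiegelTheta_sub_stirling_le`), however small `|Z|` is at the sample points —
the situation of the Odlyzko–te Riele computation, where the brackets have width `≈ 10⁻⁷⁵`
(`MertensConjectureDisproofCertificate.lean`, field `ZeroBracketing.sign`).

## Main results (namespace `Literature`, all proved)

* `re_cexp_mul_zeta_half_eq` — `Re (e^{iφ} ζ(½+it)) = Z(t) cos(φ − θ(t))`.
* `hardyZ_pos_of_re_pos`, `hardyZ_neg_of_re_neg` — the sign of `Z(t)` from a rotation by any
  `φ` with `|φ − θ(t)| < π/2`.
* `hardyZ_mul_hardyZ_neg_of_re` — a certified sign change: `Z(t₁) Z(t₂) < 0`.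
* `abs_sub_riemannSiegelTheta_lt_of_stirling` — `|φ − θ(t)| < π/2` from an enclosure of the
  Stirling main term.
* `norm_deriv_deriv_riemannZeta_le_near_line`, `norm_riemannZeta_sub_taylor_le` — `‖ζ''‖ ≤ 2(t₀+15)³`
  near `½ + it₀` (`t₀ ≥ 8`) and the second-order Taylor bound on discs of radius `r ≤ ½`.
* `hardyZ_mul_hardyZ_neg_of_center` — `Z(t₀−r) Z(t₀+r) < 0` from `ζ(½+it₀)`, `ζ'(½+it₀)` and rough
  values of `θ(t₀ ± r)` (one accurate evaluation of `ζ` per bracket).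

## References

* [EdwardsZeta1974] H. M. Edwards, *Riemann's Zeta Function*, 1974, §6.5 (`Z` and `θ`), §8.3.
* [Titchmarsh1986] E. C. Titchmarsh, *The Theory of the Riemann Zeta-Function*, §4.17.
-/

noncomputable section

open Complex Set
open scoped Real

namespace Literature.NumberTheory.LFunctions

/-- **Rotation identity**: for every real `φ`, `Re (e^{iφ} ζ(½+it)) = Z(t) cos(φ − θ(t))`.
[cite: EdwardsZeta1974, §6.5] -/
theorem re_cexp_mul_zeta_half_eq (φ t : ℝ) :
    (cexp (φ * I) * riemannZeta (1 / 2 + t * I)).re =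
      hardyZ t * Real.cos (φ - riemannSiegelTheta t) := by
  have hZ := ofReal_hardyZ_holds t
  -- `ζ(½+it) = e^{-iθ} Z(t)`
  have hζ : riemannZeta (1 / 2 + t * I) =
      cexp (-(riemannSiegelTheta t * I)) * (hardyZ t : ℂ) := by
    rw [hZ, ← mul_assoc, ← Complex.exp_add, neg_add_cancel, Complex.exp_zero, one_mul]
  rw [hζ, ← mul_assoc, ← Complex.exp_add,
    show (φ : ℂ) * I + -(riemannSiegelTheta t * I) = ((φ - riemannSiegelTheta t : ℝ) : ℂ) * I by
      push_cast; ring,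
    Complex.exp_mul_I, mul_comm]
  rw [Complex.mul_re, Complex.ofReal_re, Complex.ofReal_im, zero_mul, sub_zero,
    Complex.add_re, ← Complex.ofReal_cos, ← Complex.ofReal_sin, Complex.ofReal_re,
    Complex.mul_re, Complex.ofReal_re, Complex.ofReal_im, Complex.I_re, Complex.I_im]
  ring

/-- If `|φ − θ(t)| < π/2` and `Re (e^{iφ} ζ(½+it)) > 0` then `Z(t) > 0`. [cite: EdwardsZeta1974, §6.5 and §8.3] -/
theorem hardyZ_pos_of_re_pos {φ t : ℝ} (hφ : |φ - riemannSiegelTheta t| < π / 2)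
    (h : 0 < (cexp (φ * I) * riemannZeta (1 / 2 + t * I)).re) : 0 < hardyZ t := by
  rw [re_cexp_mul_zeta_half_eq] at h
  have hc : 0 < Real.cos (φ - riemannSiegelTheta t) := by
    have := abs_lt.1 hφ
    exact Real.cos_pos_of_mem_Ioo ⟨by linarith, by linarith⟩
  by_contra hle
  push Not at hle
  have := mul_nonpos_of_nonpos_of_nonneg hle hc.le
  linarith

/-- If `|φ − θ(t)| < π/2` and `Re (e^{iφ} ζ(½+it)) < 0` then `Z(t) < 0`. [cite: EdwardsZeta1974, §6.5 and §8.3] -/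
theorem hardyZ_neg_of_re_neg {φ t : ℝ} (hφ : |φ - riemannSiegelTheta t| < π / 2)
    (h : (cexp (φ * I) * riemannZeta (1 / 2 + t * I)).re < 0) : hardyZ t < 0 := by
  rw [re_cexp_mul_zeta_half_eq] at h
  have hc : 0 < Real.cos (φ - riemannSiegelTheta t) := by
    have := abs_lt.1 hφ
    exact Real.cos_pos_of_mem_Ioo ⟨by linarith, by linarith⟩
  by_contra hle
  push Not at hle
  have := mul_nonneg hle hc.le
  linarith

/-- **A certified sign change of `Z`.** If `|φ₁ − θ(t₁)|, |φ₂ − θ(t₂)| < π/2` and the real parts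
of `e^{iφ₁} ζ(½+it₁)` and `e^{iφ₂} ζ(½+it₂)` have opposite signs, then `Z(t₁) Z(t₂) < 0`.
[cite: EdwardsZeta1974, §8.3] -/
theorem hardyZ_mul_hardyZ_neg_of_re {φ₁ φ₂ t₁ t₂ : ℝ}
    (h₁ : |φ₁ - riemannSiegelTheta t₁| < π / 2) (h₂ : |φ₂ - riemannSiegelTheta t₂| < π / 2)
    (h : (cexp (φ₁ * I) * riemannZeta (1 / 2 + t₁ * I)).re *
        (cexp (φ₂ * I) * riemannZeta (1 / 2 + t₂ * I)).re < 0) :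
    hardyZ t₁ * hardyZ t₂ < 0 := by
  set r₁ := (cexp (φ₁ * I) * riemannZeta (1 / 2 + t₁ * I)).re
  set r₂ := (cexp (φ₂ * I) * riemannZeta (1 / 2 + t₂ * I)).re
  rcases lt_trichotomy r₁ 0 with hr | hr | hr
  · have hr₂ : 0 < r₂ := by
      by_contra hle; push Not at hle
      have := mul_nonneg_of_nonpos_of_nonpos hr.le hle
      linarith
    exact mul_neg_of_neg_of_pos (hardyZ_neg_of_re_neg h₁ hr) (hardyZ_pos_of_re_pos h₂ hr₂)
  · rw [hr, zero_mul] at h; exact absurd h (lt_irrefl 0)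
  · have hr₂ : r₂ < 0 := by
      by_contra hle; push Not at hle
      have := mul_nonneg hr.le hle
      linarith
    exact mul_neg_of_pos_of_neg (hardyZ_pos_of_re_pos h₁ hr) (hardyZ_neg_of_re_neg h₂ hr₂)

/-- `|φ − θ(t)| < π/2` from the Stirling main term: for `t ≥ 2`, if
`|φ − ((t/2) log(t/2π) − t/2 − π/8)| + 2K(¼)/t < π/2` then `|φ − θ(t)| < π/2`.
[cite: Titchmarsh1986, §4.17] -/
theorem abs_sub_riemannSiegelTheta_lt_of_stirling {φ t : ℝ} (ht : 2 ≤ t)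
    (h : |φ - (t / 2 * Real.log (t / (2 * π)) - t / 2 - π / 8)| +
        2 * stirlingVertRate (1 / 4) / t < π / 2) :
    |φ - riemannSiegelTheta t| < π / 2 := by
  have hθ := abs_riemannSiegelTheta_sub_stirling_le ht
  have := abs_sub_le φ (t / 2 * Real.log (t / (2 * π)) - t / 2 - π / 8) (riemannSiegelTheta t)
  rw [abs_sub_comm (t / 2 * Real.log (t / (2 * π)) - t / 2 - π / 8)] at this
  linarith

/-! ## Both ends of a tiny bracket from data at its centre

For brackets of width `2r ≈ 10⁻⁷⁵` around an approximate ordinate `t₀` it is wasteful to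
evaluate `ζ` to that accuracy at *both* ends: by Taylor's formula with the crude bound
`‖ζ''‖ ≤ 2(t₀+15)³` near the line (Cauchy's estimate and `‖ζ(z)‖ ≤ (t₀+15)³` on the Backlund
disc, `Literature.NumberTheory.LFunctions.norm_riemannZeta_le_on_disc`),
`ζ(½ + i(t₀ ± r)) = ζ(½+it₀) ± i r ζ'(½+it₀) + O((t₀+15)³ r²)`, and the error is far below the
resolution needed (`≈ 10⁻¹³⁴` for `r = 10⁻⁷²`). So one accurate value `ζ(½+it₀)` and a rough
value of `ζ'(½+it₀)` certify the sign change. -/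

/-- `‖ζ''(z)‖ ≤ 2(t₀+15)³` within distance `½` of the point `½ + it₀` of the critical line
(`t₀ ≥ 8`). [folklore] -/
theorem norm_deriv_deriv_riemannZeta_le_near_line {t₀ : ℝ} (ht : 8 ≤ t₀) {z : ℂ}
    (hz : z ∈ Metric.closedBall ((1 / 2 : ℂ) + t₀ * I) (1 / 2)) :
    ‖deriv (deriv riemannZeta) z‖ ≤ 2 * (t₀ + 15) ^ 3 := by
  have hzc : dist z ((1 / 2 : ℂ) + t₀ * I) ≤ 1 / 2 := Metric.mem_closedBall.1 hz
  have hc6 : dist ((1 / 2 : ℂ) + t₀ * I) ((6 : ℂ) + t₀ * I) = 11 / 2 := by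
    rw [dist_eq_norm, show (1 / 2 : ℂ) + t₀ * I - (6 + t₀ * I) = ((-(11 / 2) : ℝ) : ℂ) by
      push_cast; ring, Complex.norm_real, Real.norm_eq_abs, abs_neg,
      abs_of_pos (by norm_num)]
  -- the circle of radius `1` about `z` lies in the Backlund disc of radius `7` about `6 + it₀`
  have hsub : Metric.closedBall z 1 ⊆ Metric.closedBall ((6 : ℂ) + t₀ * I) 7 := by
    intro w hw
    rw [Metric.mem_closedBall] at hw ⊢
    linarith [dist_triangle w z ((1 / 2 : ℂ) + t₀ * I),
      dist_triangle w ((1 / 2 : ℂ) + t₀ * I) ((6 : ℂ) + t₀ * I)]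
  have hne1 : ∀ w ∈ Metric.closedBall z 1, w ≠ 1 := by
    intro w hw h1
    have hw7 := hsub hw
    rw [h1, Metric.mem_closedBall, dist_eq_norm] at hw7
    have := abs_im_le_norm (1 - ((6 : ℂ) + t₀ * I))
    simp at this
    rw [abs_le] at this
    linarith [this.2]
  have hd : DiffContOnCl ℂ riemannZeta (Metric.ball z 1) := by
    refine DifferentiableOn.diffContOnCl fun w hw ↦ ?_
    rw [closure_ball z one_ne_zero] at hw
    exact (differentiableAt_riemannZeta (hne1 w hw)).differentiableWithinAt
  have h := Complex.norm_iteratedDeriv_le_of_forall_mem_sphere_norm_le 2 one_pos hd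
    (C := (t₀ + 15) ^ 3) fun w hw ↦
      Literature.NumberTheory.LFunctions.norm_riemannZeta_le_on_disc ht (hsub (Metric.sphere_subset_closedBall hw))
  rw [iteratedDeriv_succ, iteratedDeriv_one] at h
  simpa [Nat.factorial] using h

/-- **Second-order Taylor bound on the line.** For `t₀ ≥ 8` and `‖z − (½+it₀)‖ ≤ r ≤ ½`:
`‖ζ(z) − ζ(½+it₀) − (z − (½+it₀)) ζ'(½+it₀)‖ ≤ 2 (t₀+15)³ r²`. [folklore] -/
theorem norm_riemannZeta_sub_taylor_le {t₀ r : ℝ} (ht : 8 ≤ t₀) (hr : r ≤ 1 / 2) {z : ℂ}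
    (hz : ‖z - ((1 / 2 : ℂ) + t₀ * I)‖ ≤ r) :
    ‖riemannZeta z - riemannZeta ((1 / 2 : ℂ) + t₀ * I) -
        (z - ((1 / 2 : ℂ) + t₀ * I)) * deriv riemannZeta ((1 / 2 : ℂ) + t₀ * I)‖ ≤
      2 * (t₀ + 15) ^ 3 * r ^ 2 := by
  set c : ℂ := (1 / 2 : ℂ) + t₀ * I with hc
  have hr0 : 0 ≤ r := (norm_nonneg _).trans hz
  set D := Metric.closedBall c r with hD
  have hDsub : D ⊆ Metric.closedBall c (1 / 2) := Metric.closedBall_subset_closedBall hr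
  have hconv : Convex ℝ D := convex_closedBall c r
  have hzD : z ∈ D := by rw [hD, Metric.mem_closedBall, dist_eq_norm]; exact hz
  have hcD : c ∈ D := Metric.mem_closedBall_self hr0
  have hne1 : ∀ w ∈ D, w ≠ 1 := by
    intro w hw h1
    have hw' := hDsub hw
    rw [h1, Metric.mem_closedBall, dist_eq_norm] at hw'
    have := abs_im_le_norm (1 - c)
    simp [hc] at this
    rw [abs_le] at this
    linarith [this.2]
  -- `ζ'` is `2(t₀+15)³`-Lipschitz on `D`
  have hM2 : ∀ w ∈ D, ‖deriv (deriv riemannZeta) w‖ ≤ 2 * (t₀ + 15) ^ 3 := fun w hw ↦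
    norm_deriv_deriv_riemannZeta_le_near_line ht (hDsub hw)
  have hdiff2 : ∀ w ∈ D, DifferentiableAt ℂ (deriv riemannZeta) w := by
    intro w hw
    have ha : AnalyticAt ℂ riemannZeta w := analyticOn_riemannZeta w (hne1 w hw)
    exact ha.deriv.differentiableAt
  have hLip : ∀ w ∈ D, ‖deriv riemannZeta w - deriv riemannZeta c‖ ≤ 2 * (t₀ + 15) ^ 3 * r := by
    intro w hw
    have := hconv.norm_image_sub_le_of_norm_deriv_le hdiff2 hM2 hcD hw
    refine this.trans (mul_le_mul_of_nonneg_left ?_ (by positivity))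
    rw [← dist_eq_norm]; exact Metric.mem_closedBall.1 hw
  -- apply the mean value inequality to `g(w) = ζ(w) − (w − c) ζ'(c)`
  set g : ℂ → ℂ := fun w ↦ riemannZeta w - (w - c) * deriv riemannZeta c with hg
  have hgd : ∀ w ∈ D, DifferentiableAt ℂ g w := fun w hw ↦
    (differentiableAt_riemannZeta (hne1 w hw)).sub
      ((differentiableAt_id.sub_const c).mul_const _)
  have hgderiv : ∀ w ∈ D, deriv g w = deriv riemannZeta w - deriv riemannZeta c := by
    intro w hw
    have h1 : HasDerivAt (fun w : ℂ ↦ (w - c) * deriv riemannZeta c) (deriv riemannZeta c) w := by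
      simpa using ((hasDerivAt_id w).sub_const c).mul_const (deriv riemannZeta c)
    have h2 := (differentiableAt_riemannZeta (hne1 w hw)).hasDerivAt
    exact (h2.sub h1).deriv
  have hgbound : ∀ w ∈ D, ‖deriv g w‖ ≤ 2 * (t₀ + 15) ^ 3 * r := fun w hw ↦ by
    rw [hgderiv w hw]; exact hLip w hw
  have key := hconv.norm_image_sub_le_of_norm_deriv_le hgd hgbound hcD hzD
  have e : g z - g c = riemannZeta z - riemannZeta c - (z - c) * deriv riemannZeta c := by
    simp only [hg, sub_self, zero_mul, sub_zero]
    ring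
  rw [e] at key
  calc _ ≤ 2 * (t₀ + 15) ^ 3 * r * ‖z - c‖ := key
    _ ≤ 2 * (t₀ + 15) ^ 3 * r * r := mul_le_mul_of_nonneg_left hz (by positivity)
    _ = 2 * (t₀ + 15) ^ 3 * r ^ 2 := by ring

/-- The bound `|Re (e^{iφ} w)| ≤ ‖w‖`. [folklore] -/
theorem abs_re_cexp_mul_le (φ : ℝ) (w : ℂ) : |(cexp (φ * I) * w).re| ≤ ‖w‖ := by
  refine (abs_re_le_norm _).trans ?_
  rw [norm_mul, Complex.norm_exp_ofReal_mul_I, one_mul]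

/-- **A sign change of `Z` across a tiny bracket from data at its centre.** Let `t₀ ≥ 8`,
`0 < r ≤ ½`, `W = ζ(½+it₀)`, `D = ζ'(½+it₀)`, `E = 2(t₀+15)³r²`, and let `φ₁, φ₂` be within
`π/2` of `θ(t₀ − r)`, `θ(t₀ + r)`. If `Re (e^{iφ₁}(W − irD)) < −E` and `Re (e^{iφ₂}(W + irD)) > E`,
or the same with the signs exchanged, then `Z(t₀ − r) Z(t₀ + r) < 0`. (All four quantities are
delivered by validated arithmetic: `W` to high accuracy, `D` roughly.) [cite: EdwardsZeta1974, §8.3] -/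
theorem hardyZ_mul_hardyZ_neg_of_center {t₀ r φ₁ φ₂ : ℝ} (ht : 8 ≤ t₀) (hr : 0 < r)
    (hr2 : r ≤ 1 / 2) (hφ₁ : |φ₁ - riemannSiegelTheta (t₀ - r)| < π / 2)
    (hφ₂ : |φ₂ - riemannSiegelTheta (t₀ + r)| < π / 2)
    (h : ((cexp (φ₁ * I) * (riemannZeta (1 / 2 + t₀ * I) -
              r * I * deriv riemannZeta (1 / 2 + t₀ * I))).re < -(2 * (t₀ + 15) ^ 3 * r ^ 2) ∧
          2 * (t₀ + 15) ^ 3 * r ^ 2 < (cexp (φ₂ * I) * (riemannZeta (1 / 2 + t₀ * I) +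
              r * I * deriv riemannZeta (1 / 2 + t₀ * I))).re) ∨
         (2 * (t₀ + 15) ^ 3 * r ^ 2 < (cexp (φ₁ * I) * (riemannZeta (1 / 2 + t₀ * I) -
              r * I * deriv riemannZeta (1 / 2 + t₀ * I))).re ∧
          (cexp (φ₂ * I) * (riemannZeta (1 / 2 + t₀ * I) +
              r * I * deriv riemannZeta (1 / 2 + t₀ * I))).re < -(2 * (t₀ + 15) ^ 3 * r ^ 2))) :
    hardyZ (t₀ - r) * hardyZ (t₀ + r) < 0 := by
  set c : ℂ := (1 / 2 : ℂ) + t₀ * I with hc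
  set W := riemannZeta c
  set D := deriv riemannZeta c
  set E : ℝ := 2 * (t₀ + 15) ^ 3 * r ^ 2
  -- Taylor at the two ends
  have hm : ‖((1 / 2 : ℂ) + ((t₀ - r : ℝ) : ℂ) * I) - c‖ ≤ r := by
    rw [show (1 / 2 : ℂ) + ((t₀ - r : ℝ) : ℂ) * I - c = -(r * I) by rw [hc]; push_cast; ring,
      norm_neg, norm_mul, Complex.norm_real, Complex.norm_I, mul_one, Real.norm_eq_abs,
      abs_of_pos hr]
  have hp : ‖((1 / 2 : ℂ) + ((t₀ + r : ℝ) : ℂ) * I) - c‖ ≤ r := by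
    rw [show (1 / 2 : ℂ) + ((t₀ + r : ℝ) : ℂ) * I - c = r * I by rw [hc]; push_cast; ring,
      norm_mul, Complex.norm_real, Complex.norm_I, mul_one, Real.norm_eq_abs, abs_of_pos hr]
  have Tm := norm_riemannZeta_sub_taylor_le ht hr2 hm
  have Tp := norm_riemannZeta_sub_taylor_le ht hr2 hp
  rw [show (1 / 2 : ℂ) + ((t₀ - r : ℝ) : ℂ) * I - c = -(r * I) by rw [hc]; push_cast; ring] at Tm
  rw [show (1 / 2 : ℂ) + ((t₀ + r : ℝ) : ℂ) * I - c = r * I by rw [hc]; push_cast; ring] at Tp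
  -- rotate and take real parts
  set Rm := riemannZeta ((1 / 2 : ℂ) + ((t₀ - r : ℝ) : ℂ) * I) - W - -(r * I) * D
  set Rp := riemannZeta ((1 / 2 : ℂ) + ((t₀ + r : ℝ) : ℂ) * I) - W - r * I * D
  have em : cexp (φ₁ * I) * riemannZeta (1 / 2 + ((t₀ - r : ℝ) : ℂ) * I) =
      cexp (φ₁ * I) * (W - r * I * D) + cexp (φ₁ * I) * Rm := by simp only [Rm]; ring
  have ep : cexp (φ₂ * I) * riemannZeta (1 / 2 + ((t₀ + r : ℝ) : ℂ) * I) =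
      cexp (φ₂ * I) * (W + r * I * D) + cexp (φ₂ * I) * Rp := by simp only [Rp]; ring
  have bm : |(cexp (φ₁ * I) * Rm).re| ≤ E := (abs_re_cexp_mul_le φ₁ Rm).trans Tm
  have bp : |(cexp (φ₂ * I) * Rp).re| ≤ E := (abs_re_cexp_mul_le φ₂ Rp).trans Tp
  have am := abs_le.1 bm
  have ap := abs_le.1 bp
  have rm : (cexp (φ₁ * I) * riemannZeta (1 / 2 + ((t₀ - r : ℝ) : ℂ) * I)).re =
      (cexp (φ₁ * I) * (W - r * I * D)).re + (cexp (φ₁ * I) * Rm).re := by rw [em, add_re]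
  have rp : (cexp (φ₂ * I) * riemannZeta (1 / 2 + ((t₀ + r : ℝ) : ℂ) * I)).re =
      (cexp (φ₂ * I) * (W + r * I * D)).re + (cexp (φ₂ * I) * Rp).re := by rw [ep, add_re]
  rcases h with ⟨h1, h2⟩ | ⟨h1, h2⟩
  · have s1 : (cexp (φ₁ * I) * riemannZeta (1 / 2 + ((t₀ - r : ℝ) : ℂ) * I)).re < 0 := by
      rw [rm]; linarith
    have s2 : 0 < (cexp (φ₂ * I) * riemannZeta (1 / 2 + ((t₀ + r : ℝ) : ℂ) * I)).re := by
      rw [rp]; linarith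
    exact mul_neg_of_neg_of_pos (hardyZ_neg_of_re_neg hφ₁ s1) (hardyZ_pos_of_re_pos hφ₂ s2)
  · have s1 : 0 < (cexp (φ₁ * I) * riemannZeta (1 / 2 + ((t₀ - r : ℝ) : ℂ) * I)).re := by
      rw [rm]; linarith
    have s2 : (cexp (φ₂ * I) * riemannZeta (1 / 2 + ((t₀ + r : ℝ) : ℂ) * I)).re < 0 := by
      rw [rp]; linarith
    exact mul_neg_of_pos_of_neg (hardyZ_pos_of_re_pos hφ₁ s1) (hardyZ_neg_of_re_neg hφ₂ s2)


end Literature.NumberTheory.LFunctions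

end
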